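import Summits.AtomisticToContinuum.FouriersLaw.Theorems.PhononMeanFreePathDefs
import Summits.AtomisticToContinuum.FouriersLaw.Theorems.IncoherentChannel.Negative.LineResistance

/-!
# Crux-strategist s2 sketch — crux `PhononMeanFreePath.IncoherentChannel` (stmt-AtomisticToContinuum-11811)

Typed objects behind the second strategist census `STRATEGY-CENSUS.md`
(planner-cstrat-stmt-AtomisticToContinuum-11811-s2-0, 2026-08-17). Nothing here is a route item or a
registered stub; the file certifies that the census's NEW signatures elaborate and that the glue / the
counter-certificates it quotes are real (sorry-free). Companion of the first strategist's
`StrategistSketch.lean` (s1: D1 `Converges ∧ Floor`, S1 monotone scaled conductance, S2 hydrodynamic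
profile), which is not repeated.

* `cruxIntegrand`, `incSeq` — the crux integrand `C_N − 2r_N²` and the crux sequence
  `i_N = N(γ²/T²)∫₀^∞ (C_N − 2 r_N²)`; `incoherentChannel_iff_incSeq` (definitional).
* DECOMPOSITION (D5, time windows): `LightConePiece η`, `WindowPiece η ζ`, `TailPiece ζ` with the
  sorry-free glue `incoherentChannel_of_pieces` (`0 < η ≤ ζ`, fixed-`N` integrability `CruxIntegrable`).
* STRENGTHEN (S4) `AbelProfile` + `UniformAbelTail` (signatures: the Abel/diffusive-Laplace form and the
  limit interchange it still needs); (S5) `GammaFreeKappa` (γ-independent κ, glue `incoherentChannel_of_gammaFree`);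
  (S6) `LengthAntitoneConductance` (plain monotonicity of the two-terminal conductance in the length) and
  the counter-certificate `antitone_ohmic_no_limit`: an antitone `G` with `1 ≤ N·G_N < 2` for all `N ≥ 1`
  and NO limit of `N·G_N` — so S6 + bounded response + conductance floor do NOT give the crux.
* NEGATION (N5) `farCumulant_tendsto_zero_of_incoherentChannel`: the crux forces the UNSCALED far
  cumulant integral `∫₀^∞(C_N − 2r_N²) → 0`; a counterexample must keep it from vanishing like `κT²/(γ²N)`.
-/

noncomputable section

namespace Summit.AtomisticToContinuum.FouriersLaw.Cruxes.IncoherentChannel.StrategistS2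

open MeasureTheory Set Filter Topology
open Literature.MathematicalPhysics.KineticTheory.HeatConduction
open Summit.AtomisticToContinuum.FouriersLaw.Theses.PhononMeanFreePath (IncoherentChannel CoherentDephasing)
open Summit.AtomisticToContinuum.FouriersLaw.Theorems.PhononMeanFreePath

/-! ## Vocabulary -/

/-- The crux integrand `C_N(t) − 2 r_N(t)²` (time-integrated connected fourth cumulant density of the two
end momenta). -/
def cruxIntegrand (ω₂ lam β γ T : ℝ) (N : ℕ) (t : ℝ) : ℝ :=
  powerCov ω₂ lam β γ T N t - 2 * (pairCorr ω₂ lam β γ T N t) ^ 2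

/-- The crux sequence (incoherent channel) `i_N = N(γ²/T²)∫₀^∞ (C_N − 2 r_N²) dt`. -/
def incSeq (ω₂ lam β γ T : ℝ) (N : ℕ) : ℝ :=
  (N : ℝ) * (γ ^ 2 / T ^ 2) * ∫ t in Ioi (0 : ℝ), cruxIntegrand ω₂ lam β γ T N t

/-- `incSeq` is the sequence printed in the crux. -/
theorem incSeq_eq (ω₂ lam β γ T : ℝ) (N : ℕ) :
    incSeq ω₂ lam β γ T N = (N : ℝ) * (γ ^ 2 / T ^ 2) * ∫ t in Ioi (0 : ℝ),
      ((∫ z, (z.2 0) ^ 2 * (∫ y, (y.2 (Fin.last N)) ^ 2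
          ∂((pinnedChain ω₂ lam β γ).transitionKernel (N + 1) T T t.toNNReal z))
          ∂((pinnedChain ω₂ lam β γ).gibbsMeasure (N + 1) T)) -
        (∫ z, (z.2 0) ^ 2 ∂((pinnedChain ω₂ lam β γ).gibbsMeasure (N + 1) T)) *
          (∫ z, (∫ y, (y.2 (Fin.last N)) ^ 2
            ∂((pinnedChain ω₂ lam β γ).transitionKernel (N + 1) T T t.toNNReal z))
            ∂((pinnedChain ω₂ lam β γ).gibbsMeasure (N + 1) T)) -
        2 * (∫ z, z.2 0 * (∫ y, y.2 (Fin.last N)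
          ∂((pinnedChain ω₂ lam β γ).transitionKernel (N + 1) T T t.toNNReal z))
          ∂((pinnedChain ω₂ lam β γ).gibbsMeasure (N + 1) T)) ^ 2) := by
  simp only [incSeq, cruxIntegrand, cruxIntegrand_eq]

/-- The crux in the vocabulary of this file (definitional). -/
theorem incoherentChannel_iff_incSeq :
    IncoherentChannel ↔ ∀ ω₂ lam β γ : ℝ, 0 < ω₂ → 0 < lam → 0 < β → 0 < γ → ∀ T : ℝ, 0 < T →
      ∃ κ : ℝ, 0 < κ ∧ Tendsto (incSeq ω₂ lam β γ T) atTop (𝓝 κ) := by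
  simp only [IncoherentChannel, funext (incSeq_eq _ _ _ _ _)]

/-! ## (D5) Decomposition by TIME WINDOWS: light cone / diffusive window / post-diffusive tail

`i_N = N(γ²/T²)[∫_{(0,N^η]} + ∫_{(N^η,N^ζ]} + ∫_{(N^ζ,∞)}](C_N − 2r_N²)`. Piece 1 is causality (landed for
`P_N`, `r_N²`: `stub_lightCone`, p92940; for `C_N` it needs the fourth-moment light cone), piece 3 is an
`N`-polynomial lower bound on the relaxation rate of the open anharmonic chain (spectral-gap family of
items: `LiouvilleNoGap`, `HeatModeGap`; Menegaki2020 gives `≳ N⁻³` only for `N`-dependently WEAK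
anharmonicity), and piece 2 — the diffusive window — is the whole crux. -/

/-- Fixed-`N` integrability of the crux integrand on `(0,∞)` (TRUE, landed in substance: `C_N ∈ L¹` from
`boundaryKubo_proof`, `r_N² ∈ L¹` from the forecast budget p135026; kept as an explicit hypothesis here). -/
def CruxIntegrable : Prop :=
  ∀ ω₂ lam β γ : ℝ, 0 < ω₂ → 0 < lam → 0 < β → 0 < γ → ∀ T : ℝ, 0 < T → ∀ N : ℕ,
    IntegrableOn (cruxIntegrand ω₂ lam β γ T N) (Ioi 0)

/-- **D5 piece 1 — the causal (light-cone) window carries nothing**: `N(γ²/T²)∫_{(0,N^η]}(C_N − 2r_N²) → 0`. -/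
def LightConePiece (η : ℝ) : Prop :=
  ∀ ω₂ lam β γ : ℝ, 0 < ω₂ → 0 < lam → 0 < β → 0 < γ → ∀ T : ℝ, 0 < T →
    Tendsto (fun N : ℕ => (N : ℝ) * (γ ^ 2 / T ^ 2) *
      ∫ t in Ioc (0 : ℝ) ((N : ℝ) ^ η), cruxIntegrand ω₂ lam β γ T N t) atTop (𝓝 0)

/-- **D5 piece 2 — the diffusive window carries `κ`**: `N(γ²/T²)∫_{(N^η,N^ζ]}(C_N − 2r_N²) → κ > 0`.
THIS is the piece that remains the whole crux (the hydrodynamic window `N ≪ t ≲ N²·O(1)`). -/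
def WindowPiece (η ζ : ℝ) : Prop :=
  ∀ ω₂ lam β γ : ℝ, 0 < ω₂ → 0 < lam → 0 < β → 0 < γ → ∀ T : ℝ, 0 < T →
    ∃ κ : ℝ, 0 < κ ∧ Tendsto (fun N : ℕ => (N : ℝ) * (γ ^ 2 / T ^ 2) *
      ∫ t in Ioc ((N : ℝ) ^ η) ((N : ℝ) ^ ζ), cruxIntegrand ω₂ lam β γ T N t) atTop (𝓝 κ)

/-- **D5 piece 3 — the post-diffusive tail carries nothing**: `N(γ²/T²)∫_{(N^ζ,∞)}(C_N − 2r_N²) → 0`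
(for `ζ > 3` it would follow from an `L²(μ₀)` relaxation rate `≳ N⁻³` of the OPEN ANHARMONIC chain — open). -/
def TailPiece (ζ : ℝ) : Prop :=
  ∀ ω₂ lam β γ : ℝ, 0 < ω₂ → 0 < lam → 0 < β → 0 < γ → ∀ T : ℝ, 0 < T →
    Tendsto (fun N : ℕ => (N : ℝ) * (γ ^ 2 / T ^ 2) *
      ∫ t in Ioi ((N : ℝ) ^ ζ), cruxIntegrand ω₂ lam β γ T N t) atTop (𝓝 0)

/-- Splitting `∫_{(0,∞)}` at `0 ≤ a ≤ b` for an integrable function (real analysis). -/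
theorem integral_Ioi_split {f : ℝ → ℝ} {a b : ℝ} (hf : IntegrableOn f (Ioi 0)) (ha : 0 ≤ a)
    (hab : a ≤ b) :
    ∫ t in Ioi (0 : ℝ), f t =
      (∫ t in Ioc (0 : ℝ) a, f t) + (∫ t in Ioc a b, f t) + ∫ t in Ioi b, f t := by
  have hb : 0 ≤ b := ha.trans hab
  have h1 : ∫ t in Ioi (0 : ℝ), f t = (∫ t in Ioc (0 : ℝ) a, f t) + ∫ t in Ioi a, f t := by
    rw [← setIntegral_union (Ioc_disjoint_Ioi le_rfl) measurableSet_Ioi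
      (hf.mono_set Ioc_subset_Ioi_self) (hf.mono_set (Ioi_subset_Ioi ha)), Ioc_union_Ioi_eq_Ioi ha]
  have h2 : ∫ t in Ioi a, f t = (∫ t in Ioc a b, f t) + ∫ t in Ioi b, f t := by
    rw [← setIntegral_union (Ioc_disjoint_Ioi le_rfl) measurableSet_Ioi
      ((hf.mono_set (Ioi_subset_Ioi ha)).mono_set Ioc_subset_Ioi_self)
      (hf.mono_set (Ioi_subset_Ioi hb)), Ioc_union_Ioi_eq_Ioi hab]
  rw [h1, h2, add_assoc]

/-- **Glue of D5** (sorry-free): fixed-`N` integrability + the three window statements with exponents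
`0 < η ≤ ζ` give the crux, with the `κ` of the diffusive window. -/
theorem incoherentChannel_of_pieces {η ζ : ℝ} (_hη : 0 < η) (hηζ : η ≤ ζ)
    (hI : CruxIntegrable) (h₁ : LightConePiece η) (h₂ : WindowPiece η ζ) (h₃ : TailPiece ζ) :
    IncoherentChannel := by
  rw [incoherentChannel_iff_incSeq]
  intro ω₂ lam β γ hω hl hβ hγ T hT
  obtain ⟨κ, hκ, hW⟩ := h₂ ω₂ lam β γ hω hl hβ hγ T hT
  refine ⟨κ, hκ, ?_⟩
  have hL := h₁ ω₂ lam β γ hω hl hβ hγ T hT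
  have hTl := h₃ ω₂ lam β γ hω hl hβ hγ T hT
  have hsum := (hL.add hW).add hTl
  simp only [zero_add, add_zero] at hsum
  refine hsum.congr' ?_
  filter_upwards [eventually_ge_atTop 1] with N hN
  have hN1 : (1 : ℝ) ≤ N := by exact_mod_cast hN
  have ha : 0 ≤ (N : ℝ) ^ η := Real.rpow_nonneg (by linarith) η
  have hab : (N : ℝ) ^ η ≤ (N : ℝ) ^ ζ := Real.rpow_le_rpow_of_exponent_le hN1 hηζ
  have hf := hI ω₂ lam β γ hω hl hβ hγ T hT N
  rw [incSeq, integral_Ioi_split hf ha hab]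
  ring

/-! ## (S4) Strengthen: the Abel / diffusive-Laplace form, and the limit interchange it still needs -/

/-- **S4 — Abel profile at diffusive frequency**: for every `s > 0` the Laplace-weighted channel
`N(γ²/T²)∫₀^∞ e^{−st/N²}(C_N − 2r_N²) → K(s)`, and `K(s) → κ > 0` as `s → 0⁺` (the resolvent of the open
generator read at `ν = s/N²`; each fixed `s` is a diffusive-window statement). -/
def AbelProfile : Prop :=
  ∀ ω₂ lam β γ : ℝ, 0 < ω₂ → 0 < lam → 0 < β → 0 < γ → ∀ T : ℝ, 0 < T →
    ∃ K : ℝ → ℝ, (∀ s : ℝ, 0 < s → Tendsto (fun N : ℕ => (N : ℝ) * (γ ^ 2 / T ^ 2) *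
        ∫ t in Ioi (0 : ℝ), Real.exp (-(s * t / (N : ℝ) ^ 2)) * cruxIntegrand ω₂ lam β γ T N t)
        atTop (𝓝 (K s))) ∧
      ∃ κ : ℝ, 0 < κ ∧ Tendsto K (𝓝[>] 0) (𝓝 κ)

/-- **What S4 still needs to reach the crux — uniform Abelian tail** (interchange of `s → 0⁺` and `N → ∞`):
the mass of the channel beyond the Laplace cut-off `N²/s` is small uniformly in large `N` as `s → 0⁺`. This is
route `AbelianSqueeze`'s item `UniformAbelianRegularity` in channel clothes. -/
def UniformAbelTail : Prop :=
  ∀ ω₂ lam β γ : ℝ, 0 < ω₂ → 0 < lam → 0 < β → 0 < γ → ∀ T : ℝ, 0 < T →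
    ∀ ε : ℝ, 0 < ε → ∃ s₀ : ℝ, 0 < s₀ ∧ ∀ s : ℝ, 0 < s → s < s₀ → ∀ᶠ N : ℕ in atTop,
      |(N : ℝ) * (γ ^ 2 / T ^ 2) * ∫ t in Ioi (0 : ℝ),
          (1 - Real.exp (-(s * t / (N : ℝ) ^ 2))) * cruxIntegrand ω₂ lam β γ T N t| < ε

/-! ## (S5) Strengthen: `κ` independent of the bath coupling `γ` -/

/-- **S5 — bath-independent conductivity**: one `κ(ω₂, lam, β, T) > 0` serves EVERY `γ > 0` (bulk conductivity
does not see the contacts). Physically right, logically stronger than the crux (`κ` after `γ`). -/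
def GammaFreeKappa : Prop :=
  ∀ ω₂ lam β : ℝ, 0 < ω₂ → 0 < lam → 0 < β → ∀ T : ℝ, 0 < T →
    ∃ κ : ℝ, 0 < κ ∧ ∀ γ : ℝ, 0 < γ → Tendsto (incSeq ω₂ lam β γ T) atTop (𝓝 κ)

/-- Glue (one line): S5 ⇒ the crux. -/
theorem incoherentChannel_of_gammaFree (h : GammaFreeKappa) : IncoherentChannel := by
  rw [incoherentChannel_iff_incSeq]
  intro ω₂ lam β γ hω hl hβ hγ T hT
  obtain ⟨κ, hκ, hlim⟩ := h ω₂ lam β hω hl hβ T hT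
  exact ⟨κ, hκ, hlim γ hγ⟩

/-! ## (S6) Strengthen: plain monotonicity of the two-terminal conductance in the length — and why it is
orthogonal to the crux -/

/-- **S6 — the two-terminal conductance `G_N = (γ²/T²)∫₀^∞ C_N` is non-increasing in `N`** (a longer chain
conducts less; by the landed sum rule `G_N = γ·(far-exit fraction of an energy pulse)`, so this is "exit through
the far bath is less likely the farther it is"). Weaker than s1's S1 (monotone SCALED conductance `N·G_N`). -/
def LengthAntitoneConductance : Prop :=
  ∀ ω₂ lam β γ : ℝ, 0 < ω₂ → 0 < lam → 0 < β → 0 < γ → ∀ T : ℝ, 0 < T →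
    Antitone (fun N : ℕ => (γ ^ 2 / T ^ 2) * ∫ t in Ioi (0 : ℝ), powerCov ω₂ lam β γ T N t)

/-- **Counter-certificate for S6** (pure real analysis): there is an ANTITONE sequence `G` with the two-sided
Ohmic bounds `1 ≤ N·G_N < 2` for all `N ≥ 1` whose scaled sequence `N·G_N` has NO limit (`G_N = 2^{-⌊log₂ N⌋}`:
`N·G_N` sweeps `[1,2)` on every dyadic block). Hence length-monotonicity of the conductance together with
`BoundedResponse` (stmt-11071) and `ConductanceLowerBound` (stmt-11749) does NOT give Fourier's law / the crux:
S6 is not a strengthening that feeds `closes`. -/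
theorem antitone_ohmic_no_limit :
    ∃ G : ℕ → ℝ, Antitone G ∧ (∀ N : ℕ, 1 ≤ N → 1 ≤ (N : ℝ) * G N ∧ (N : ℝ) * G N < 2) ∧
      ¬ ∃ κ : ℝ, Tendsto (fun N : ℕ => (N : ℝ) * G N) atTop (𝓝 κ) := by
  refine ⟨fun N => ((2 : ℝ) ^ Nat.log 2 N)⁻¹, ?_, ?_, ?_⟩
  · intro m n hmn
    exact inv_anti₀ (by positivity) (pow_le_pow_right₀ (by norm_num) (Nat.log_mono_right hmn))
  · intro N hN
    have hN0 : N ≠ 0 := by omega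
    have h1 : 2 ^ Nat.log 2 N ≤ N := Nat.pow_log_le_self 2 hN0
    have h2 : N < 2 ^ (Nat.log 2 N + 1) := Nat.lt_pow_succ_log_self (by norm_num) N
    have hpos : (0 : ℝ) < (2 : ℝ) ^ Nat.log 2 N := by positivity
    constructor
    · rw [le_mul_inv_iff₀ hpos, one_mul]
      exact_mod_cast h1
    · rw [mul_inv_lt_iff₀ hpos]
      have : (N : ℝ) < (2 : ℝ) ^ (Nat.log 2 N + 1) := by exact_mod_cast h2
      calc (N : ℝ) < (2 : ℝ) ^ (Nat.log 2 N + 1) := this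
        _ = 2 * (2 : ℝ) ^ Nat.log 2 N := by ring
  · rintro ⟨κ, hκ⟩
    -- along `N = 2^k` the scaled sequence is identically `1`
    have hA : Tendsto (fun k : ℕ => ((2 ^ k : ℕ) : ℝ) * ((2 : ℝ) ^ Nat.log 2 (2 ^ k))⁻¹)
        atTop (𝓝 κ) :=
      hκ.comp (tendsto_pow_atTop_atTop_of_one_lt (one_lt_two : (1 : ℕ) < 2))
    have hA' : (fun k : ℕ => ((2 ^ k : ℕ) : ℝ) * ((2 : ℝ) ^ Nat.log 2 (2 ^ k))⁻¹) = fun _ => (1 : ℝ) := by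
      funext k
      rw [Nat.log_pow (by norm_num)]
      push_cast
      exact mul_inv_cancel₀ (by positivity)
    -- along `N = 3·2^k` it is identically `3/2`
    have hφ : Tendsto (fun k : ℕ => 3 * 2 ^ k) atTop atTop :=
      tendsto_atTop_mono (fun k => Nat.le_mul_of_pos_left (2 ^ k) (by norm_num))
        (tendsto_pow_atTop_atTop_of_one_lt (one_lt_two : (1 : ℕ) < 2))
    have hB : Tendsto (fun k : ℕ => ((3 * 2 ^ k : ℕ) : ℝ) * ((2 : ℝ) ^ Nat.log 2 (3 * 2 ^ k))⁻¹)
        atTop (𝓝 κ) :=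
      hκ.comp hφ
    have hlog : ∀ k : ℕ, Nat.log 2 (3 * 2 ^ k) = k + 1 := by
      intro k
      have hk : 0 < 2 ^ k := Nat.two_pow_pos k
      rw [Nat.log_eq_iff (Or.inl (Nat.succ_ne_zero k))]
      constructor
      · rw [pow_succ]; omega
      · rw [pow_succ, pow_succ]; omega
    have hB' : (fun k : ℕ => ((3 * 2 ^ k : ℕ) : ℝ) * ((2 : ℝ) ^ Nat.log 2 (3 * 2 ^ k))⁻¹) =
        fun _ => (3 / 2 : ℝ) := by
      funext k
      rw [hlog k, pow_succ]
      push_cast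
      have h2k : (0 : ℝ) < (2 : ℝ) ^ k := by positivity
      field_simp
      try ring
    rw [hA'] at hA
    rw [hB'] at hB
    have h1 : κ = 1 := tendsto_nhds_unique hA tendsto_const_nhds
    have h2 : κ = 3 / 2 := tendsto_nhds_unique hB tendsto_const_nhds
    norm_num [h1] at h2

/-! ## (N5) Negation target: the far cumulant integral must vanish exactly like `κT²/(γ²N)` -/

/-- **The crux forces the unscaled far cumulant channel to vanish**: `∫₀^∞(C_N − 2r_N²) dt → 0`
(indeed `= κT²/(γ²N)(1 + o(1))`). Together with the landed `N`-uniform cumulant floor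
`∫(C_N − 2r_N²) + ∫(A_N − 2a_N²) ≥ c > 0` (p159295) this pins a counterexample programme: it must keep the FAR
cumulant integral of order one (superdiffusive incoherent transport) or make it oscillate around `κT²/(γ²N)`. -/
theorem farCumulant_tendsto_zero_of_incoherentChannel (h : IncoherentChannel) :
    ∀ ω₂ lam β γ : ℝ, 0 < ω₂ → 0 < lam → 0 < β → 0 < γ → ∀ T : ℝ, 0 < T →
      Tendsto (fun N : ℕ => ∫ t in Ioi (0 : ℝ), cruxIntegrand ω₂ lam β γ T N t) atTop (𝓝 0) := by
  intro ω₂ lam β γ hω hl hβ hγ T hT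
  obtain ⟨κ, -, hκ⟩ := (incoherentChannel_iff_incSeq.1 h) ω₂ lam β γ hω hl hβ hγ T hT
  have hc : 0 < γ ^ 2 / T ^ 2 := by positivity
  have h1 : Tendsto (fun N : ℕ => incSeq ω₂ lam β γ T N / ((N : ℝ) * (γ ^ 2 / T ^ 2))) atTop (𝓝 0) :=
    hκ.div_atTop (tendsto_natCast_atTop_atTop.atTop_mul_const hc)
  refine h1.congr' ?_
  filter_upwards [eventually_ge_atTop 1] with N hN
  have hN' : (0 : ℝ) < N := Nat.cast_pos.mpr hN
  rw [incSeq]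
  exact mul_div_cancel_left₀ _ (mul_ne_zero hN'.ne' hc.ne')

end Summit.AtomisticToContinuum.FouriersLaw.Cruxes.IncoherentChannel.StrategistS2

end
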